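import Literature.AlgebraicGeometry.ComplexMultiplication.EndAlgebraCentralDegreeSquare
import Literature.AlgebraicGeometry.ComplexMultiplication.CenterEndAlgebraTotallyRealOrCMOfRiemann
import Literature.AlgebraicGeometry.Motives.AbelianVarietyDimZeroProofs
import Literature.NumberTheory.Automorphic.QuaternionAlgebraAdelic
import HarnessLib

/-!
# Albert's invariant `d ≤ 2` for simple complex abelian varieties of dimension `≤ 7`: `End⁰(B)` is commutative or a quaternion algebra over its centre — from `d²e ∣ 2 dim B` alone

Family `hodge`, cell `pub-hodge-ring2` (Literature lane gen 81, programme R58). HONEST FRAMING (verbatim for the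
cell): research route conditional on HC_CM; not a corollary; Q11.4-sentence-2 already refuted in dim ≥ 3. This file is
UNCONDITIONAL endomorphism-algebra arithmetic; theorems only, no definition, no named fact, nothing about the Hodge
conjecture.

THE PRINT. D. Mumford, *Abelian Varieties* (1970), §21 Thm. 2 (Albert) and the table (pp. 201–202): for `X` simple,
`D = End⁰(X)` a division algebra with centre `K`, `e = [K:ℚ]`, `d² = [D:K]`; «Type I: `d = 1`; Type II, III: `d = 2`;
Type IV: … `e d² ∣ 2g`» (in characteristic `0`); Ch. Birkenhake, H. Lange, *Complex Abelian Varieties*, §5.5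
Prop. 5.5.7 (held text §2.6.1, PDF p. 139 L1): «`dim_ℚ F = ed²` divides `2g`»; B. Moonen, Yu. Zarhin, Math. Ann. 315
(1999) §1 (1.1). In print the bound `d ≤ 2` for the types I–III is Albert's theorem — its proof uses that a central
division algebra over a number field has exponent equal to index (Albert–Brauer–Hasse–Noether), which neither Mathlib
nor the tree has.

THIS FILE proves the slice of «`d ≤ 2`» that follows from the tree's row `d² e ∣ 2 dim B`
(`exists_sq_mul_finrank_center_dvd_two_mul_dim`, sibling `EndAlgebraCentralDegreeSquare`) by ARITHMETIC ALONE: `d ≥ 3`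
needs `9 ∣ 2 dim B` or `16 ∣ 2 dim B`, impossible for `0 < dim B ≤ 7`. Hence, with no class field theory:
* §1 `sq_dvd_two_mul_le_two` — `d² ∣ 2g`, `0 < g ≤ 7` ⟹ `d ≤ 2`.
* §2 `AbelianVariety.exists_isQuaternionAlgebra_centerField` — for `B` simple of positive dimension with
  `[End⁰(B):ℚ] = 4·[Z(End⁰ B):ℚ]` (Albert's `d = 2`), `End⁰(B)` IS A QUATERNION ALGEBRA OVER ITS CENTRE, the tree's
  number field `CenterField B` (the `Algebra`/`IsScalarTower` structure and the tree's class `IsQuaternionAlgebra` are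
  delivered as existential witnesses — no instance is declared).
* §3 **`AbelianVariety.endAlgebra_comm_or_exists_isQuaternionAlgebra_of_isSimple_of_dim_le_seven`** — EVERY SIMPLE
  COMPLEX ABELIAN VARIETY OF DIMENSION `≤ 7` HAS `End⁰` COMMUTATIVE (`d = 1`) OR A QUATERNION ALGEBRA OVER A NUMBER FIELD
  (`d = 2`, over its centre) — exactly the «Albert SHAPE» datum consumed by the Literature lane's Hazama theorem
  `HodgeTheory.IsStablyNondegenerate.prod_of_isIsogenous_productOf_comm_or_quaternion`; also the forms
  `…_of_forall_sq_dvd` (any dimension, hypothesis «`d² ∣ 2 dim B ⟹ d ≤ 2`») and `…_of_dim_pos_…`.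
The first dimension NOT covered is `8` (`d = 4`, `e = 1`, `2g = 16`): there only Albert–Brauer–Hasse–Noether excludes a
division algebra of index `4` and exponent `2` as `End⁰` of a simple abelian eightfold of type I–III.

## References
* [MumfordAV1970] D. Mumford, *Abelian Varieties* (1970), §19 Cor. 2 of Thm. 1 (p. 174), §21 Thm. 2 and table (pp. 201–202).
* [LangeBirkenhake1992] Ch. Birkenhake, H. Lange, *Complex Abelian Varieties*, §5.5 Prop. 5.5.7 (held text §2.6.1, PDF p. 137 L7, p. 139 L1).
* [MoonenZarhin1999LowDim] B. Moonen, Yu. Zarhin, Math. Ann. 315 (1999) 711–733, §1 (1.1).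
* [Shimura1998] G. Shimura, *Abelian Varieties with Complex Multiplication and Modular Functions* (1998), §5.1 Prop. 5 (p. 36) (the centre as a number field).
* [VignerasLNM800] M.-F. Vignéras, *Arithmétique des algèbres de quaternions*, LNM 800, Ch. I §1 (quaternion algebra = central simple of dimension 4).
-/

noncomputable section

open CategoryTheory Module
open scoped TensorProduct

namespace Literature.AlgebraicGeometry.ComplexMultiplication

open Literature.AlgebraicGeometry.Motives (AbelianVariety)
open Literature.AlgebraicGeometry.Motives.AbelianVariety
open Literature.NumberTheory.Automorphic (IsQuaternionAlgebra)

variable {B : AbelianVariety ℂ}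

/-! ### §1 Arithmetic: `d² ∣ 2g` with `0 < g ≤ 7` forces `d ≤ 2` -/

/-- **`d² ∣ 2g`, `0 < g ≤ 7` ⟹ `d ≤ 2`**: a square `≥ 9` dividing an even number `≤ 14` would be `9 ∣ 2g`, i.e.
`2g = 9` — the arithmetic behind «Type II, III: `d = 2`» in dimension `≤ 7` (Mumford's table, row `e d² ∣ 2g`).
[cite: MumfordAV1970, §21 (pp. 201–202)] -/
theorem sq_dvd_two_mul_le_two {d g : ℕ} (hg0 : 0 < g) (hg : g ≤ 7) (h : d ^ 2 ∣ 2 * g) : d ≤ 2 := by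
  have hle : d ^ 2 ≤ 2 * g := Nat.le_of_dvd (by omega) h
  by_contra hd
  have hd4 : d < 4 := by nlinarith
  interval_cases d
  norm_num at h
  omega

/-! ### §2 Albert's `d = 2`: `End⁰(B)` is a quaternion algebra over its centre -/

/-- **A number field `K` mapped centrally ONTO the centre of a simple finite-dimensional `ℚ`-algebra `D` with
`[D:ℚ] = 4[K:ℚ]` is the centre of a QUATERNION ALGEBRA structure on `D`** (`D` becomes a central simple `K`-algebra of
dimension `4` — Vignéras' definition, the tree's class `IsQuaternionAlgebra`; the `Algebra`/`IsScalarTower` structure and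
the class are returned as existential witnesses, no instance is declared). Generic algebra (Albert's `d = 2` packaged);
the same statement is proved summit-side as `Summit.HodgeConjecture.Ring2.RowFourClosed.exists_quaternionAlgebra_of_center`
(cell `pub-hodge-ring2`, gen 75) — restated here because `Literature/` cannot import `Summits/`.
[cite: VignerasLNM800, Ch. I §1] [cite: MumfordAV1970, §21 (pp. 201–202)] -/
theorem exists_isQuaternionAlgebra_of_ringHom_onto_center {D : Type} [Ring D] [Algebra ℚ D] [Module.Finite ℚ D]
    (hS : IsSimpleRing D) (K : Type) [Field K] [NumberField K] (i : K →+* D) (hi : ∀ c x, i c * x = x * i c)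
    (hrange : ∀ x ∈ Subalgebra.center ℚ D, x ∈ Set.range i) (hK : Module.finrank ℚ K * 4 = Module.finrank ℚ D) :
    ∃ (_ : Algebra K D) (_ : IsScalarTower ℚ K D), IsQuaternionAlgebra K D := by
  letI iA : Algebra K D := i.toAlgebra' hi
  have halg : algebraMap K D = i := RingHom.algebraMap_toAlgebra' i hi
  haveI iT : IsScalarTower ℚ K D := IsScalarTower.of_algebraMap_eq fun r => by
    have h := RingHom.ext_rat ((algebraMap K D).comp (algebraMap ℚ K)) (algebraMap ℚ D)
    exact (DFunLike.congr_fun h r).symm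
  haveI : Algebra.IsCentral K D := ⟨fun x hx => by
    obtain ⟨k, hk⟩ := hrange x (Subalgebra.mem_center_iff.2 fun b => Subalgebra.mem_center_iff.1 hx b)
    exact Algebra.mem_bot.2 ⟨k, by rw [halg, hk]⟩⟩
  have hKpos : 0 < Module.finrank ℚ K := Module.finrank_pos
  have h4 : Module.finrank K D = 4 := by
    have h := Module.finrank_mul_finrank ℚ K D
    rw [← hK] at h
    exact Nat.eq_of_mul_eq_mul_left hKpos h
  exact ⟨iA, iT, ⟨hS, h4⟩⟩

/-- **`End⁰(B)` of a simple complex abelian variety with `[End⁰(B):ℚ] = 4·[Z(End⁰ B):ℚ]` is a QUATERNION ALGEBRA OVER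
ITS CENTRE `K = Z(End⁰ B)`** (the tree's number field `CenterField B`): `End⁰(B)` is a `K`-algebra through the inclusion
of the centre `CenterField.val` (compatible with the `ℚ`-structure), CENTRAL over `K` by construction, SIMPLE (a division
algebra, Mumford §19 Cor. 2: the tree's `isSimpleRing_endAlgebra_of_isSimple`) and of dimension `[End⁰(B):K] = 4` by the
tower law. [cite: MumfordAV1970, §19 Cor. 2 of Thm. 1 (p. 174) and §21 Thm. 2]
[cite: VignerasLNM800, Ch. I §1] [cite: Shimura1998, §5.1 Proposition 5 (p. 36)] -/
theorem AbelianVariety.exists_isQuaternionAlgebra_centerField (hB : B.IsSimple) (hB0 : 0 < B.dim)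
    (h4 : Module.finrank ℚ B.endAlgebra = 4 * Module.finrank ℚ (Subalgebra.center ℚ B.endAlgebra)) :
    ∃ (_ : Algebra (CenterField B hB hB0) B.endAlgebra) (_ : IsScalarTower ℚ (CenterField B hB hB0) B.endAlgebra),
      IsQuaternionAlgebra (CenterField B hB hB0) B.endAlgebra := by
  haveI : Module.Finite ℚ B.endAlgebra := AbelianVariety.finiteDimensional_endAlgebra_holds B
  have hKZ : Module.finrank ℚ (CenterField B hB hB0) = Module.finrank ℚ (Subalgebra.center ℚ B.endAlgebra) :=
    ((ratModule_transfer (M := CenterField B hB hB0)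
      (show Module ℚ ↥(Subalgebra.center ℚ B.endAlgebra) from inferInstance) _).1).symm
  exact exists_isQuaternionAlgebra_of_ringHom_onto_center (isSimpleRing_endAlgebra_of_isSimple hB hB0)
    (CenterField B hB hB0) (CenterField.val hB hB0)
    (fun c x => (Subalgebra.mem_center_iff.1 (show Subalgebra.center ℚ B.endAlgebra from c).2 x).symm)
    (fun x hx => ⟨(show CenterField B hB hB0 from ⟨x, hx⟩), rfl⟩) (by rw [hKZ, h4, mul_comm])

/-! ### §3 The Albert shape of `End⁰` of a simple abelian variety of dimension `≤ 7` -/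

/-- `End⁰` of a zero-dimensional abelian variety is the zero ring (every endomorphism vanishes, the tree's
`hom_eq_zero_of_dim_eq_zero`), in particular commutative. [cite: MumfordAV1970, §19 (p. 176, `End⁰(X) = End(X) ⊗ ℚ`)] -/
theorem AbelianVariety.endAlgebra_mul_comm_of_dim_eq_zero (h0 : B.dim = 0) (x y : B.endAlgebra) : x * y = y * x := by
  have hE : ∀ f : End B, f = 0 := fun f => hom_eq_zero_of_dim_eq_zero (Or.inl h0) f
  have hs : ∀ z : ℚ ⊗[ℤ] End B, z = 0 := fun z => by
    induction z using TensorProduct.induction_on with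
    | zero => rfl
    | tmul q f => rw [hE f, TensorProduct.tmul_zero]
    | add a b ha hb => rw [ha, hb, add_zero]
  haveI : Subsingleton B.endAlgebra := ⟨fun a b => (hs a).trans (hs b).symm⟩
  exact Subsingleton.elim _ _

/-- **Albert shape from «`d² ∣ 2 dim B ⟹ d ≤ 2`»** (any dimension): for `B` simple of positive dimension such that no
square `d² ≥ 9` divides `2 dim B`, `End⁰(B)` is commutative (`d = 1`: the centre is everything,
`center_eq_top_of_finrank_eq`) or a quaternion algebra over its centre (`d = 2`, §2).
[cite: MumfordAV1970, §21 Thm. 2 and table (pp. 201–202)] [cite: LangeBirkenhake1992, §5.5 Prop. 5.5.7]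
[cite: MoonenZarhin1999LowDim, §1 (1.1)] -/
theorem AbelianVariety.endAlgebra_comm_or_exists_isQuaternionAlgebra_centerField_of_forall_sq_dvd (hB : B.IsSimple)
    (hB0 : 0 < B.dim) (hsq : ∀ d : ℕ, d ^ 2 ∣ 2 * B.dim → d ≤ 2) :
    (∀ x y : B.endAlgebra, x * y = y * x) ∨
      ∃ (_ : Algebra (CenterField B hB hB0) B.endAlgebra) (_ : IsScalarTower ℚ (CenterField B hB hB0) B.endAlgebra),
        IsQuaternionAlgebra (CenterField B hB hB0) B.endAlgebra := by
  haveI : Module.Finite ℚ B.endAlgebra := AbelianVariety.finiteDimensional_endAlgebra_holds B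
  obtain ⟨d, hd, hde, hdvd⟩ := exists_sq_mul_finrank_center_dvd_two_mul_dim hB hB0
  have hd2 : d ≤ 2 := hsq d (dvd_trans (dvd_mul_right _ _) hdvd)
  interval_cases d
  · left
    rw [one_pow, one_mul] at hde
    have htop := center_eq_top_of_finrank_eq hde
    intro x y
    have hy : y ∈ Subalgebra.center ℚ B.endAlgebra := by rw [htop]; exact Algebra.mem_top
    exact Subalgebra.mem_center_iff.1 hy x
  · right
    exact AbelianVariety.exists_isQuaternionAlgebra_centerField hB hB0 (by rw [hde]; norm_num)

/-- **Dimension `≤ 7`, positive: `End⁰(B)` of a SIMPLE complex abelian variety `B` with `0 < dim B ≤ 7` is commutative or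
a quaternion algebra over its centre `CenterField B`** (§1 + the previous theorem).
[cite: MumfordAV1970, §21 Thm. 2 and table (pp. 201–202)] [cite: LangeBirkenhake1992, §5.5 Prop. 5.5.7] -/
theorem AbelianVariety.endAlgebra_comm_or_exists_isQuaternionAlgebra_centerField_of_dim_le_seven (hB : B.IsSimple)
    (hB0 : 0 < B.dim) (h7 : B.dim ≤ 7) :
    (∀ x y : B.endAlgebra, x * y = y * x) ∨
      ∃ (_ : Algebra (CenterField B hB hB0) B.endAlgebra) (_ : IsScalarTower ℚ (CenterField B hB hB0) B.endAlgebra),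
        IsQuaternionAlgebra (CenterField B hB hB0) B.endAlgebra :=
  AbelianVariety.endAlgebra_comm_or_exists_isQuaternionAlgebra_centerField_of_forall_sq_dvd hB hB0
    fun _ h => sq_dvd_two_mul_le_two hB0 h7 h

/-- **THE ALBERT SHAPE OF A SIMPLE COMPLEX ABELIAN VARIETY OF DIMENSION `≤ 7`: `End⁰(B)` is commutative, or a
quaternion algebra over SOME number field** (its centre) — the datum «commutative ∨ `∃ K, IsQuaternionAlgebra K End⁰(B)`»
of the Literature lane's Hazama theorem `IsStablyNondegenerate.prod_of_isIsogenous_productOf_comm_or_quaternion`,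
UNCONDITIONALLY for every simple `B` with `dim B ≤ 7` (dimension `0`: the zero ring). In print this holds in every
dimension for the types I–III (Albert, via Albert–Brauer–Hasse–Noether); here only the arithmetic slice `d² ∣ 2g ≤ 14`.
[cite: MumfordAV1970, §21 Thm. 2 and table (pp. 201–202)] [cite: LangeBirkenhake1992, §5.5 Prop. 5.5.7]
[cite: MoonenZarhin1999LowDim, §1 (1.1)] -/
theorem AbelianVariety.endAlgebra_comm_or_exists_isQuaternionAlgebra_of_isSimple_of_dim_le_seven (hB : B.IsSimple)
    (h7 : B.dim ≤ 7) :
    (∀ x y : B.endAlgebra, x * y = y * x) ∨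
      ∃ (K : Type) (_ : Field K) (_ : NumberField K) (_ : Algebra K B.endAlgebra) (_ : IsScalarTower ℚ K B.endAlgebra),
        IsQuaternionAlgebra K B.endAlgebra := by
  rcases Nat.eq_zero_or_pos B.dim with h0 | hB0
  · exact Or.inl (AbelianVariety.endAlgebra_mul_comm_of_dim_eq_zero h0)
  · rcases AbelianVariety.endAlgebra_comm_or_exists_isQuaternionAlgebra_centerField_of_dim_le_seven hB hB0 h7 with
      hcomm | ⟨iA, iT, hQ⟩
    · exact Or.inl hcomm
    · exact Or.inr ⟨CenterField B hB hB0, inferInstance, inferInstance, iA, iT, hQ⟩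

/-- The same from the arithmetic hypothesis «`d² ∣ 2 dim B ⟹ d ≤ 2`» in any dimension (e.g. `dim B = 9, 10, 11, 15, …`
are NOT covered, `dim B ≤ 7` and `dim B ∈ {10, 11, 13, 14, 15, …}` with `2 dim B` free of squares `≥ 9` are).
[cite: MumfordAV1970, §21 Thm. 2 and table (pp. 201–202)] [cite: LangeBirkenhake1992, §5.5 Prop. 5.5.7] -/
theorem AbelianVariety.endAlgebra_comm_or_exists_isQuaternionAlgebra_of_isSimple_of_forall_sq_dvd (hB : B.IsSimple)
    (hsq : ∀ d : ℕ, 3 ≤ d → ¬ d ^ 2 ∣ 2 * B.dim) :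
    (∀ x y : B.endAlgebra, x * y = y * x) ∨
      ∃ (K : Type) (_ : Field K) (_ : NumberField K) (_ : Algebra K B.endAlgebra) (_ : IsScalarTower ℚ K B.endAlgebra),
        IsQuaternionAlgebra K B.endAlgebra := by
  rcases Nat.eq_zero_or_pos B.dim with h0 | hB0
  · exact Or.inl (AbelianVariety.endAlgebra_mul_comm_of_dim_eq_zero h0)
  · rcases AbelianVariety.endAlgebra_comm_or_exists_isQuaternionAlgebra_centerField_of_forall_sq_dvd hB hB0
        (fun d hd => by by_contra h; exact hsq d (by omega) hd) with hcomm | ⟨iA, iT, hQ⟩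
    · exact Or.inl hcomm
    · exact Or.inr ⟨CenterField B hB hB0, inferInstance, inferInstance, iA, iT, hQ⟩

end Literature.AlgebraicGeometry.ComplexMultiplication

end
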